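/-
Copyright (c) 2026 the pub-hodgecm-mathlib formalisation cell (harness21).  Prover seat hodgecm-mathlib-F0P3a-p08 (g20): road «S3-ram» (LEAD F0P3a-plan (g13);
owner F0P3a-p06), (T2) G-side organ (Cnt2′) (chair F0P3a-p07 (g14∕g15) RULINGS (9)(b)∕(10)(3)), organ (z6) «FIX-FINITE, BLOCK LITERAL», part (z6-f)
«THE ROOT REGION OF THE ANISOTROPIC LITERAL IS THE ROOT» (F0P2-p02 (g14) 2026-09-02T03:44:00Z: the `sR := {r₀}` hypothesis of `strataCount_J₀_block_raw_singleton`); 2026-09-02.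
-/
import Literature.NumberTheory.Automorphic.UnitaryLatticeTreeBlockFixedFiniteOppositeLiteral   -- ★ p848762 (this seat): `mem_unitaryGroupOfForm_formCongr_of_coe_eq_conj`; brings ★ TubeCone (`cone_anatomy_of_tubeCoordinate`, `forall_mulVec_mem_scaleLattice_iff_of_cone`, `scaleLattice_axisVertex_le`), ★ TubeAxisVertex, ★ TubeCoordinate, ★ AnisotropicPlane, ★ FormTransport, ★ BlockFixedFinite (`le_scaleLattice_inv_pow_axisVertex`)
import Literature.NumberTheory.Automorphic.UnitaryLatticeTreeTubeCollarTokens               -- ★ p848616 (F0P2-p01 (g16)): `endoGL_sub_one_sub_smul_one`, `endoGL_sub_one_col`, `endoGL_sub_one_row`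
import Literature.NumberTheory.Automorphic.UnitaryLatticeTreeTypeTwoParent                   -- ★ `scaleLattice_one`
import HarnessLib

/-!
# The lattice graph of a hermitian space — for the anisotropic block literal `ι(γ₁, u)` the only self-dual lattice of root level `ϖ^{d₀}` is the root `𝒪³`, as soon as
# `γ₁ − u₀₀·1` contracts no primitive vector below `ϖ^{d₀}`; the root region `{γ·v = v ∧ SD ∧ LEV(ϖ^{d₀})}` of `P·ι(γ₁,u)·P⁻¹` in the `Φ₃`-model is `{r₀}`
# (Bruhat–Tits 1972 §10; Kottwitz 1986 §3)

Topic `NumberTheory/Automorphic`; namespace `Literature.NumberTheory.Automorphic.UnitaryLatticeTree`.  THEOREMS ONLY (no definition, no instance, no notation, no named fact,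
no `sorry`); kernel lane `--supports stmt-HodgeConjecture-24833`; datum-free (`K` with `Valued K ℤᵐ⁰`; `[IsPrincipalIdealRing 𝒪[K]]` for the axis-vertex basis, discharged
downstream by ★ `isPrincipalIdealRing_integer_adicCompletion`).  Cell `pub/hodgecm-mathlib` (D-0151), crux H413; road «S3-ram» (Literature seeding, count-neutral); (T2) G-side
organ (Cnt2′), organ **(z6) «FIX-FINITE, BLOCK LITERAL»**, part **(z6-f)**: route-B keeper F0P2-p02 (g14) reads the closed total of the ANISOTROPIC type-(2) literal
`t₁ = P·ι(γ₁, u)·P⁻¹` off ★ `strataCount_J₀_of_charpoly_block_raw` with `sR := {r₀}`, under ONE hypothesis: «no fixed self-dual vertex off the axis has `LEV(ϖ^{d₀})`», i.e.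
the root region `R = {v ∣ γ·v = v ∧ SD v ∧ LEV[v](ϖ^{d₀})}` is `{r₀}`.  THIS FILE proves that hypothesis from a checkable NON-CONTRACTION condition on `T := γ₁ − u₀₀·1`.

THE MATHEMATICS.  Block model `H = ι-shape(diag d, η)` with `diag d` RESIDUALLY ANISOTROPIC (`|d i| = 1`, `hanis₀`, `hanis₁`: `|h(x,x)| = max(|x₀|,|x₁|)²`, ★
`valued_pairing_self_eq_max_sq`), `|η| = 1`; `Γ = ι(γ₁, u)`.  Let `M` be self-dual with `(Γ − 1)·M ≤ ϖ^{d₀}·M`.  It has a tube coordinate `b` and an axis vertex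
`A(M) = latt ι(g₂, 1)` with `latt g₂` self-dual for `diag d` (★ `exists_axisVertex_eq_latt_endoGL`), hence `latt g₂ = 𝒪²` (★ `eq_stdLattice_of_isSelfDualLattice_of_anisotropic`)
and **`A(M) = 𝒪³`**.  If `b = 0` then `M = A(M) = 𝒪³`.  If `b ≥ 1`, ★ (c3-iv′) LEVELS ON THE CONE (`forall_mulVec_mem_scaleLattice_iff_of_cone` with `S = Γ − 1`, `c = ϖ^{d₀}`;
`S − S₁₁·1 = Γ − u₀₀·1`) gives `(Γ − u₀₀·1)z ∈ ϖ^{b+d₀}·A(M) = ϖ^{b+d₀}𝒪³` for `z = ϖ^b·pr_W x₀`, whose `W`-part `z_W` is PRIMITIVE in `𝒪²` (★ (c3-ii): `|⟨z,z⟩| = 1`, and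
`|⟨z_W, z_W⟩_{diag d}| = max² `); but `(Γ − u₀₀·1)z = ι(T z_W, 0)`, so `T` contracts the primitive `z_W` into `ϖ^{d₀+1}𝒪²` — excluded by the hypothesis
`hT : ∀ y ∈ 𝒪² primitive, ∃ i, |ϖ|^{d₀} ≤ |(T y) i|`.  So `M = 𝒪³` (§1), the set `{M ∣ SD ∧ Γ·M = M ∧ LEV(ϖ^{d₀})}` is `{𝒪³}` (§2), and along `M ↦ P·M` (★
`isSelfDualLattice_formCongr_iff`, ★ `map_conj_sub_one_le_scaleLattice_iff`) the root region of `γ` (`↑γ = P·Γ·P⁻¹`, `P·𝒪³ = 𝒪³`, `γ ∈ K₀`) in the `Φ₃`-model is `{r₀}` (§3).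
HONEST CAVEAT.  `hT` says `v_min(T) ≤ d₀` together with «`T∕ϖ^{v_min T}` is residually invertible»; the latter is automatic for `γ₁ ∈ U(σ, diag d)` anisotropic (sequel), the
former FAILS exactly in the COLLAPSE regime `γ₁ ∈ u₀₀·(a deeper unitary)`, where the root region is a ball and `sR := {r₀}` is not the right census.

* §1 `endoGL_sub_smul_one_mulVec_eq` (`(Γ − u₀₀·1)x = ι(T x_W, 0)`), `axisVertex_eq_stdLattice_of_anisotropic` (`A(M) = 𝒪³`), `exists_valued_eq_one_of_pairing_self_eq_one`
  (a vector of `𝒪²` of unit anisotropic norm is primitive), **`eq_stdLattice_of_selfDual_lev_of_anisotropic`** (THM 1).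
* §2 **`setOf_selfDual_fixed_lev_eq_singleton_of_anisotropic`** (THM 2, block model).
* §3 **`setOf_latticeGraphIso_selfDual_lev_eq_singleton_of_coe_eq_conj_endoGL`** (THM 3, `Φ₃`-model: the set of `strataCount_J₀_block`'s `hsR` is `{r₀}`),
  **`eq_root_of_latticeGraphIso_selfDual_lev_of_coe_eq_conj_endoGL`** (THM 4 = the `hR` binder of ★ `strataCount_J₀_of_charpoly_block_raw_singleton`, pointwise).

HONEST LABEL: HC_CM is proved only modulo the 2 remaining named inputs (hLiu418 24832, h413 24833) until rung 0 closes; nothing printed is asserted here (elementary lattice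
bookkeeping); «S3-ram» has no books consequence.

## References
* [BruhatTits1972] F. Bruhat, J. Tits, *Groupes réductifs sur un corps local I*, Publ. Math. IHÉS 41 (1972), §10 (lattice models; the building of an anisotropic group is a point).
* [Kottwitz1986] R. E. Kottwitz, *Base change for unit elements of Hecke algebras*, Compositio Math. 60 (1986), §3 (fixed lattices of a block element).
* [Serre1980Trees] J.-P. Serre, *Trees* (1980), Ch. II §1.1 (lattices, distance from the root).
* [Rogawski1990] J. D. Rogawski, *Automorphic Representations of Unitary Groups in Three Variables*, Ann. of Math. Stud. 123 (1990), §4.8 Case (a) p. 53, §4.9 pp. 54–56.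
-/

set_option autoImplicit false

noncomputable section

open scoped Valued WithZero Matrix MatrixGroups

namespace Literature.NumberTheory.Automorphic.UnitaryLatticeTree

open Literature.NumberTheory.Automorphic Literature.NumberTheory.Automorphic.HermitianLattice Literature.NumberTheory.Rogawski1990

variable {K : Type*} [Field K] [Valued K ℤᵐ⁰]

/-! ## §1 The only self-dual lattice of root level for the anisotropic block literal is the root -/

omit [Valued K ℤᵐ⁰] in
/-- `(Γ − u₀₀·1)·x = ι(T·x_W, 0)` for `Γ = ι(γ₁, u)`, `T = γ₁ − u₀₀·1`. [cite: Rogawski1990, §4.8 Case (a) p. 53] -/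
theorem endoGL_sub_smul_one_mulVec_eq (γ₁ : GL (Fin 2) K) (u : GL (Fin 1) K) (x : Fin 3 → K) :
    (((endoGL (γ₁, u) : GL (Fin 3) K) : Matrix (Fin 3) (Fin 3) K) - (u : Matrix (Fin 1) (Fin 1) K) 0 0 • (1 : Matrix (Fin 3) (Fin 3) K)) *ᵥ x =
      ![(((γ₁ : Matrix (Fin 2) (Fin 2) K) - (u : Matrix (Fin 1) (Fin 1) K) 0 0 • (1 : Matrix (Fin 2) (Fin 2) K)) *ᵥ ![x 0, x 2]) 0, 0,
        (((γ₁ : Matrix (Fin 2) (Fin 2) K) - (u : Matrix (Fin 1) (Fin 1) K) 0 0 • (1 : Matrix (Fin 2) (Fin 2) K)) *ᵥ ![x 0, x 2]) 1] := by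
  rw [coe_endoGL_eq_endoShape]
  ext i
  fin_cases i <;> simp [Matrix.mulVec, dotProduct, Fin.sum_univ_three, Fin.sum_univ_two, Matrix.one_apply]

/-- **THE AXIS VERTEX OF THE ANISOTROPIC BLOCK IS THE ROOT**: for `M` self-dual for `ι-shape(diag d, η)` (`diag d` residually anisotropic) with tube coordinate `b`,
`A(M) = (M ∩ W) ⊔ ϖ^b·M ⊔ 𝒪e₁ = 𝒪³` (★ `A(M) = latt ι(g₂,1)` with `latt g₂` self-dual for `diag d`, hence `= 𝒪²`). [cite: BruhatTits1972, §10] [cite: Kottwitz1986, §3] -/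
theorem axisVertex_eq_stdLattice_of_anisotropic [IsPrincipalIdealRing 𝒪[K]] (σ : K →+* K) (hσ : ∀ a, σ (σ a) = a) (hvσ : ∀ a, Valued.v (σ a) = Valued.v a)
    {ϖ : K} (hϖ : Valued.v ϖ = WithZero.exp (-1 : ℤ))
    {d : Fin 2 → K} (hd : ∀ i, Valued.v (d i) = 1) (hdσ : ∀ i, σ (d i) = d i)
    (hanis₀ : ∀ c : K, Valued.v c ≤ 1 → Valued.v (d 0 + d 1 * (σ c * c)) = 1)
    (hanis₁ : ∀ c : K, Valued.v c ≤ 1 → Valued.v (d 0 * (σ c * c) + d 1) = 1)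
    {η : K} (hη : Valued.v η = 1) (hησ : σ η = η)
    {M : Submodule 𝒪[K] (Fin 3 → K)}
    (hM : IsSelfDualLattice σ ϖ (!![(Matrix.diagonal d) 0 0, 0, (Matrix.diagonal d) 0 1; 0, η, 0; (Matrix.diagonal d) 1 0, 0, (Matrix.diagonal d) 1 1] : Matrix (Fin 3) (Fin 3) K) M)
    {b : ℕ} (hb : ∀ c : K, (Pi.single 1 c : Fin 3 → K) ∈ M ↔ Valued.v c ≤ Valued.v ϖ ^ b) :
    M ⊓ LinearMap.ker ((LinearMap.proj (1 : Fin 3) : (Fin 3 → K) →ₗ[K] K).restrictScalars 𝒪[K]) ⊔ scaleLattice (ϖ ^ b) M ⊔ Submodule.span 𝒪[K] {(Pi.single 1 1 : Fin 3 → K)} =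
      stdLattice K 3 := by
  have hϖ0 : ϖ ≠ 0 := fun h0 => by rw [h0, map_zero] at hϖ; exact WithZero.coe_ne_zero hϖ.symm
  have hϖ1 : Valued.v ϖ ≤ 1 := by rw [hϖ, ← WithZero.exp_zero]; exact WithZero.exp_le_exp.2 (by norm_num)
  have hd0 : ∀ i, d i ≠ 0 := fun i h0 => by have h := hd i; rw [h0, map_zero] at h; exact zero_ne_one h
  have hH₂ : IsUnit (Matrix.diagonal d).det := by
    rw [Matrix.det_diagonal]; exact isUnit_iff_ne_zero.2 (Finset.prod_ne_zero_iff.2 fun i _ => hd0 i)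
  have hH₂σ : ((Matrix.diagonal d).map σ)ᵀ = Matrix.diagonal d := by
    rw [Matrix.diagonal_map (map_zero σ), Matrix.diagonal_transpose]; exact congrArg Matrix.diagonal (funext hdσ)
  obtain ⟨g₂, hSD₂, hA, -⟩ := exists_axisVertex_eq_latt_endoGL σ hσ hvσ hϖ hH₂ hH₂σ hη hησ hM hb
  have hg₂ : latt (g₂ : Matrix (Fin 2) (Fin 2) K) = latt ((1 : GL (Fin 2) K) : Matrix (Fin 2) (Fin 2) K) := by
    rw [eq_stdLattice_of_isSelfDualLattice_of_anisotropic hvσ hd hanis₀ hanis₁ hϖ0 hϖ1 hSD₂, Units.val_one, latt_one]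
  rw [← hA, (latt_endoGL_one_eq_iff g₂ 1).2 hg₂, show ((1 : GL (Fin 2) K), (1 : GL (Fin 1) K)) = 1 from rfl, map_one, Units.val_one, latt_one]

/-- A vector of `𝒪²` of unit norm for a residually anisotropic `diag d` is PRIMITIVE: `|⟨x,x⟩| = max(|x₀|,|x₁|)² = 1 ⇒ ∃ i, |x i| = 1`. [cite: BruhatTits1972, §10] -/
theorem exists_valued_eq_one_of_pairing_self_eq_one {σ : K →+* K} (hvσ : ∀ a, Valued.v (σ a) = Valued.v a) {d : Fin 2 → K}
    (hanis₀ : ∀ c : K, Valued.v c ≤ 1 → Valued.v (d 0 + d 1 * (σ c * c)) = 1)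
    (hanis₁ : ∀ c : K, Valued.v c ≤ 1 → Valued.v (d 0 * (σ c * c) + d 1) = 1)
    {x : Fin 2 → K} (hx1 : Valued.v (pairing σ (Matrix.diagonal d) x x) = 1) : ∃ i, Valued.v (x i) = 1 := by
  have hx : x ≠ 0 := by
    rintro rfl
    simp at hx1
  rw [valued_pairing_self_eq_max_sq hvσ hanis₀ hanis₁ hx] at hx1
  set m := max (Valued.v (x 0)) (Valued.v (x 1)) with hm
  have hm1 : m = 1 := by
    rcases lt_trichotomy m 1 with hlt | heq | hgt
    · exact absurd hx1 (ne_of_lt (mul_lt_one_of_nonneg_of_lt_one_left zero_le hlt hlt.le))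
    · exact heq
    · exact absurd hx1 (ne_of_gt (one_lt_mul_of_lt_of_le hgt hgt.le))
  rcases max_choice (Valued.v (x 0)) (Valued.v (x 1)) with h0 | h1
  · exact ⟨0, by rw [← h0, ← hm, hm1]⟩
  · exact ⟨1, by rw [← h1, ← hm, hm1]⟩

set_option maxHeartbeats 800000 in
-- budget only: statement-heavy block tokens.
/-- **THM 1 — THE ONLY SELF-DUAL LATTICE OF ROOT LEVEL FOR THE ANISOTROPIC BLOCK LITERAL IS THE ROOT.**  Block model `ι-shape(diag d, η)`, `diag d` residually anisotropic,
`Γ = ι(γ₁, u)`, `T := γ₁ − u₀₀·1`.  If `T` contracts NO primitive vector of `𝒪²` into `ϖ^{d₀+1}𝒪²` (`hT`), then every self-dual `M` with `(Γ − 1)·M ≤ ϖ^{d₀}·M` is `𝒪³`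
(no fixedness assumed): off the axis (`b ≥ 1`) ★ (c3-iv′) would force `T z_W ∈ ϖ^{b+d₀}𝒪²` for the primitive `z_W`. [cite: Kottwitz1986, §3] [cite: BruhatTits1972, §10] -/
theorem eq_stdLattice_of_selfDual_lev_of_anisotropic [IsPrincipalIdealRing 𝒪[K]] (σ : K →+* K) (hσ : ∀ a, σ (σ a) = a) (hvσ : ∀ a, Valued.v (σ a) = Valued.v a)
    {ϖ : K} (hϖ : Valued.v ϖ = WithZero.exp (-1 : ℤ))
    {d : Fin 2 → K} (hd : ∀ i, Valued.v (d i) = 1) (hdσ : ∀ i, σ (d i) = d i)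
    (hanis₀ : ∀ c : K, Valued.v c ≤ 1 → Valued.v (d 0 + d 1 * (σ c * c)) = 1)
    (hanis₁ : ∀ c : K, Valued.v c ≤ 1 → Valued.v (d 0 * (σ c * c) + d 1) = 1)
    {η : K} (hη : Valued.v η = 1) (hησ : σ η = η) (γ₁ : GL (Fin 2) K) (u : GL (Fin 1) K) {d₀ : ℕ}
    (hT : ∀ y : Fin 2 → K, (∀ i, Valued.v (y i) ≤ 1) → (∃ i, Valued.v (y i) = 1) →
      ∃ i, Valued.v ϖ ^ d₀ ≤ Valued.v ((((γ₁ : Matrix (Fin 2) (Fin 2) K) - (u : Matrix (Fin 1) (Fin 1) K) 0 0 • (1 : Matrix (Fin 2) (Fin 2) K)) *ᵥ y) i))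
    {M : Submodule 𝒪[K] (Fin 3 → K)}
    (hM : IsSelfDualLattice σ ϖ (!![(Matrix.diagonal d) 0 0, 0, (Matrix.diagonal d) 0 1; 0, η, 0; (Matrix.diagonal d) 1 0, 0, (Matrix.diagonal d) 1 1] : Matrix (Fin 3) (Fin 3) K) M)
    (hlev : ∀ x ∈ M, ((((endoGL (γ₁, u) : GL (Fin 3) K) : Matrix (Fin 3) (Fin 3) K) - 1) *ᵥ x) ∈ scaleLattice (ϖ ^ d₀) M) :
    M = stdLattice K 3 := by
  have hϖ0' : Valued.v ϖ ≠ 0 := by rw [hϖ]; exact WithZero.exp_ne_zero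
  have hϖ0 : ϖ ≠ 0 := fun h0 => by rw [h0, map_zero] at hϖ0'; exact hϖ0' rfl
  have hϖ1 : Valued.v ϖ ≤ 1 := by rw [hϖ, ← WithZero.exp_zero]; exact WithZero.exp_le_exp.2 (by norm_num)
  have hd0 : ∀ i, d i ≠ 0 := fun i h0 => by have h := hd i; rw [h0, map_zero] at h; exact zero_ne_one h
  have hH₂ : IsUnit (Matrix.diagonal d).det := by
    rw [Matrix.det_diagonal]; exact isUnit_iff_ne_zero.2 (Finset.prod_ne_zero_iff.2 fun i _ => hd0 i)
  obtain ⟨b, hb, -, x₀, hx₀, hx₀1⟩ := exists_tubeCoordinate σ hvσ hϖ hH₂ hη hM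
  have hA0 := axisVertex_eq_stdLattice_of_anisotropic σ hσ hvσ hϖ hd hdσ hanis₀ hanis₁ hη hησ hM hb
  rcases Nat.eq_zero_or_pos b with rfl | hb1
  · -- ON THE AXIS: `M = A(M) = 𝒪³`
    refine le_antisymm ?_ ?_
    · have h := le_scaleLattice_inv_pow_axisVertex hϖ0 M 0
      rwa [hA0, pow_zero, inv_one, scaleLattice_one] at h
    · have h := scaleLattice_axisVertex_le hϖ hb
      rwa [hA0, pow_zero, scaleLattice_one] at h
  · -- OFF THE AXIS: contradiction
    exfalso
    have hcol : ∀ l : Fin 3, l ≠ 1 → ((((endoGL (γ₁, u) : GL (Fin 3) K) : Matrix (Fin 3) (Fin 3) K) - 1)) l 1 = 0 := fun l hl => endoGL_sub_one_col γ₁ u l hl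
    have hrow : ∀ l : Fin 3, l ≠ 1 → ((((endoGL (γ₁, u) : GL (Fin 3) K) : Matrix (Fin 3) (Fin 3) K) - 1)) 1 l = 0 := fun l hl => endoGL_sub_one_row γ₁ u l hl
    obtain ⟨-, -, hgen, -⟩ := (forall_mulVec_mem_scaleLattice_iff_of_cone σ hvσ hϖ hH₂ hη hM hb1 hb hx₀ hx₀1 hcol hrow (pow_ne_zero d₀ hϖ0)).1 hlev
    rw [endoGL_sub_one_sub_smul_one, hA0, endoGL_sub_smul_one_mulVec_eq, mem_scaleLattice_iff (mul_ne_zero (pow_ne_zero b hϖ0) (pow_ne_zero d₀ hϖ0)), mem_stdLattice] at hgen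
    -- the `W`-part of `z` is primitive
    obtain ⟨-, hzz, -, -⟩ := cone_anatomy_of_tubeCoordinate σ hvσ hϖ hH₂ hη hM hb1 hb hx₀ hx₀1
    set z : Fin 3 → K := (ϖ ^ b) • (x₀ - Pi.single 1 (x₀ 1)) with hzdef
    have hz1 : z 1 = 0 := by simp [hzdef]
    rw [pairing_endoShape_apply, hz1, map_zero, zero_mul, zero_mul, add_zero] at hzz
    have hzA : z ∈ stdLattice K 3 := by
      rw [← hA0]; exact (cone_anatomy_of_tubeCoordinate σ hvσ hϖ hH₂ hη hM hb1 hb hx₀ hx₀1).1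
    rw [mem_stdLattice] at hzA
    have hzW : ∀ i, Valued.v ((![z 0, z 2] : Fin 2 → K) i) ≤ 1 := fun i => by fin_cases i <;> simp [hzA]
    obtain ⟨i, hi⟩ := hT _ hzW (exists_valued_eq_one_of_pairing_self_eq_one hvσ hanis₀ hanis₁ hzz)
    -- the contraction
    have hsmall : Valued.v ((((γ₁ : Matrix (Fin 2) (Fin 2) K) - (u : Matrix (Fin 1) (Fin 1) K) 0 0 • (1 : Matrix (Fin 2) (Fin 2) K)) *ᵥ ![z 0, z 2]) i) ≤
        Valued.v ϖ ^ (b + d₀) := by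
      have hpos : 0 < Valued.v (ϖ ^ b * ϖ ^ d₀) := zero_lt_iff.2 ((Valuation.ne_zero_iff _).2 (mul_ne_zero (pow_ne_zero b hϖ0) (pow_ne_zero d₀ hϖ0)))
      have key : ∀ t : K, Valued.v ((ϖ ^ b * ϖ ^ d₀)⁻¹ * t) ≤ 1 → Valued.v t ≤ Valued.v ϖ ^ (b + d₀) := fun t ht => by
        rw [map_mul, map_inv₀, inv_mul_le_iff₀ hpos, mul_one, map_mul, map_pow, map_pow, ← pow_add] at ht; exact ht
      fin_cases i
      · exact key _ (by simpa using hgen 0)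
      · exact key _ (by simpa using hgen 2)
    have hlt : Valued.v ϖ ^ (b + d₀) < Valued.v ϖ ^ d₀ := by
      rw [v_pow_eq_exp_neg hϖ, v_pow_eq_exp_neg hϖ, WithZero.exp_lt_exp]; omega
    exact absurd (hi.trans hsmall) (not_le.2 hlt)

/-! ## §2 The set form in the block model -/

/-- `(Γ − 1)·M ≤ c·M` in `Submodule.map` spelling gives the pointwise form. [cite: Serre1980Trees, II.1.1] -/
theorem forall_mulVec_mem_scaleLattice_of_map_le {N : ℕ} (A : Matrix (Fin N) (Fin N) K) (c : K) (M : Submodule 𝒪[K] (Fin N → K))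
    (h : M.map ((Matrix.toLin' A).restrictScalars 𝒪[K]) ≤ scaleLattice c M) : ∀ x ∈ M, A *ᵥ x ∈ scaleLattice c M := fun x hx => by
  have hx' := h (Submodule.mem_map_of_mem (f := (Matrix.toLin' A).restrictScalars 𝒪[K]) hx)
  rwa [LinearMap.restrictScalars_apply, Matrix.toLin'_apply] at hx'

set_option maxHeartbeats 800000 in
-- budget only: statement-heavy block tokens.
/-- **THM 2 — THE ROOT REGION OF THE ANISOTROPIC BLOCK LITERAL (block model)**: under `hT`, `{M ∣ SD M ∧ Γ·M = M ∧ (Γ−1)·M ≤ ϖ^{d₀}·M} = {𝒪³}`, given that the root itself is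
`Γ`-fixed with `LEV(ϖ^{d₀})`. [cite: Kottwitz1986, §3] [cite: BruhatTits1972, §10] -/
theorem setOf_selfDual_fixed_lev_eq_singleton_of_anisotropic [IsPrincipalIdealRing 𝒪[K]] (σ : K →+* K) (hσ : ∀ a, σ (σ a) = a) (hvσ : ∀ a, Valued.v (σ a) = Valued.v a)
    {ϖ : K} (hϖ : Valued.v ϖ = WithZero.exp (-1 : ℤ))
    {d : Fin 2 → K} (hd : ∀ i, Valued.v (d i) = 1) (hdσ : ∀ i, σ (d i) = d i)
    (hanis₀ : ∀ c : K, Valued.v c ≤ 1 → Valued.v (d 0 + d 1 * (σ c * c)) = 1)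
    (hanis₁ : ∀ c : K, Valued.v c ≤ 1 → Valued.v (d 0 * (σ c * c) + d 1) = 1)
    {η : K} (hη : Valued.v η = 1) (hησ : σ η = η) (γ₁ : GL (Fin 2) K) (u : GL (Fin 1) K) {d₀ : ℕ}
    (hT : ∀ y : Fin 2 → K, (∀ i, Valued.v (y i) ≤ 1) → (∃ i, Valued.v (y i) = 1) →
      ∃ i, Valued.v ϖ ^ d₀ ≤ Valued.v ((((γ₁ : Matrix (Fin 2) (Fin 2) K) - (u : Matrix (Fin 1) (Fin 1) K) 0 0 • (1 : Matrix (Fin 2) (Fin 2) K)) *ᵥ y) i))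
    (hfix0 : mapGL (endoGL (γ₁, u)) (stdLattice K 3) = stdLattice K 3)
    (hroot : (stdLattice K 3).map ((Matrix.toLin' ((((endoGL (γ₁, u) : GL (Fin 3) K) : Matrix (Fin 3) (Fin 3) K) - 1))).restrictScalars 𝒪[K]) ≤
      scaleLattice (ϖ ^ d₀) (stdLattice K 3)) :
    {M : Submodule 𝒪[K] (Fin 3 → K) |
        IsSelfDualLattice σ ϖ (!![(Matrix.diagonal d) 0 0, 0, (Matrix.diagonal d) 0 1; 0, η, 0; (Matrix.diagonal d) 1 0, 0, (Matrix.diagonal d) 1 1] : Matrix (Fin 3) (Fin 3) K) M ∧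
        mapGL (endoGL (γ₁, u)) M = M ∧
        M.map ((Matrix.toLin' ((((endoGL (γ₁, u) : GL (Fin 3) K) : Matrix (Fin 3) (Fin 3) K) - 1))).restrictScalars 𝒪[K]) ≤ scaleLattice (ϖ ^ d₀) M} =
      {stdLattice K 3} := by
  have hϖ1 : Valued.v ϖ ≤ 1 := by rw [hϖ, ← WithZero.exp_zero]; exact WithZero.exp_le_exp.2 (by norm_num)
  have hHd : (!![(Matrix.diagonal d) 0 0, 0, (Matrix.diagonal d) 0 1; 0, η, 0; (Matrix.diagonal d) 1 0, 0, (Matrix.diagonal d) 1 1] : Matrix (Fin 3) (Fin 3) K) =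
      Matrix.diagonal ![d 0, η, d 1] := by
    ext i j; fin_cases i <;> fin_cases j <;> simp [Matrix.diagonal]
  have hd3 : ∀ i, Valued.v ((![d 0, η, d 1] : Fin 3 → K) i) = 1 := fun i => by fin_cases i <;> simp [hd, hη]
  have hSD0 : IsSelfDualLattice σ ϖ (!![(Matrix.diagonal d) 0 0, 0, (Matrix.diagonal d) 0 1; 0, η, 0; (Matrix.diagonal d) 1 0, 0, (Matrix.diagonal d) 1 1] : Matrix (Fin 3) (Fin 3) K)
      (stdLattice K 3) := by
    rw [hHd]; exact isSelfDualLattice_stdLattice_diagonal σ hϖ1 hd3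
  ext M
  simp only [Set.mem_setOf_eq, Set.mem_singleton_iff]
  constructor
  · rintro ⟨hM, -, hlev⟩
    exact eq_stdLattice_of_selfDual_lev_of_anisotropic σ hσ hvσ hϖ hd hdσ hanis₀ hanis₁ hη hησ γ₁ u hT hM
      (forall_mulVec_mem_scaleLattice_of_map_le _ _ _ hlev)
  · rintro rfl
    exact ⟨hSD0, hfix0, hroot⟩

/-! ## §3 The root region of `P·ι(γ₁, u)·P⁻¹` in the `Φ₃`-model -/

set_option maxHeartbeats 800000 in
-- budget only: statement-heavy lattice tokens.
/-- **THM 3 — THE ROOT REGION OF THE ANISOTROPIC LITERAL IN THE `Φ₃`-MODEL IS `{r₀}`** (the `sR := {r₀}` hypothesis of F0P2-p02's `strataCount_J₀_block_raw_singleton`):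
for `γ ∈ K₀ = unitaryInt` with `↑γ = P·ι(γ₁, u)·P⁻¹`, `P·𝒪³ = 𝒪³`, `formCongr σ P Φ₃ = ι-shape(diag d, η)` (★ `exists_vDeep_oppositeLiteral_frame_ram`), root level
`hroot : (γ − 1)·𝒪³ ≤ ϖ^{d₀}𝒪³` and the non-contraction `hT`:
`{v ∣ γ·v = v ∧ SD v.1 ∧ (γ−1)·v.1 ≤ ϖ^{d₀}·v.1} = {r₀}`. [cite: Kottwitz1986, §3] [cite: BruhatTits1972, §10] [cite: Rogawski1990, §4.9 pp. 54–56] -/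
theorem setOf_latticeGraphIso_selfDual_lev_eq_singleton_of_coe_eq_conj_endoGL [IsPrincipalIdealRing 𝒪[K]] {σ : K →+* K} {ϖ : K}
    (hσ : ∀ a, σ (σ a) = a) (hvσ : ∀ a, Valued.v (σ a) = Valued.v a) (hϖ : Valued.v ϖ = WithZero.exp (-1 : ℤ))
    {d : Fin 2 → K} {η : K} (P : GL (Fin 3) K)
    (hP : formCongr σ P ((StdForm.antidiagonal 3).over K) =
      !![(Matrix.diagonal d) 0 0, 0, (Matrix.diagonal d) 0 1; 0, η, 0; (Matrix.diagonal d) 1 0, 0, (Matrix.diagonal d) 1 1])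
    (hP0 : mapGL P (stdLattice K 3) = stdLattice K 3)
    (hd : ∀ i, Valued.v (d i) = 1) (hdσ : ∀ i, σ (d i) = d i)
    (hanis₀ : ∀ c : K, Valued.v c ≤ 1 → Valued.v (d 0 + d 1 * (σ c * c)) = 1)
    (hanis₁ : ∀ c : K, Valued.v c ≤ 1 → Valued.v (d 0 * (σ c * c) + d 1) = 1)
    (hησ : σ η = η) (hη : Valued.v η = 1)
    (γ : unitaryGroupOfForm σ ((StdForm.antidiagonal 3).over K)) (hγ0 : γ ∈ unitaryInt σ ((StdForm.antidiagonal 3).over K))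
    (γ₁ : GL (Fin 2) K) (u : GL (Fin 1) K) (hγ : (γ : GL (Fin 3) K) = P * endoGL (γ₁, u) * P⁻¹) {d₀ : ℕ}
    (hT : ∀ y : Fin 2 → K, (∀ i, Valued.v (y i) ≤ 1) → (∃ i, Valued.v (y i) = 1) →
      ∃ i, Valued.v ϖ ^ d₀ ≤ Valued.v ((((γ₁ : Matrix (Fin 2) (Fin 2) K) - (u : Matrix (Fin 1) (Fin 1) K) 0 0 • (1 : Matrix (Fin 2) (Fin 2) K)) *ᵥ y) i))
    (hroot : (stdLattice K 3).map ((Matrix.toLin' (((γ : GL (Fin 3) K) : Matrix (Fin 3) (Fin 3) K) - 1)).restrictScalars 𝒪[K]) ≤ scaleLattice (ϖ ^ d₀) (stdLattice K 3)) :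
    {v : {M : Submodule 𝒪[K] (Fin 3 → K) // IsVertex σ ϖ ((StdForm.antidiagonal 3).over K) M} |
        latticeGraphIso σ ϖ ((StdForm.antidiagonal 3).over K) γ v = v ∧ IsSelfDualLattice σ ϖ ((StdForm.antidiagonal 3).over K) v.1 ∧
          v.1.map ((Matrix.toLin' (((γ : GL (Fin 3) K) : Matrix (Fin 3) (Fin 3) K) - 1)).restrictScalars 𝒪[K]) ≤ scaleLattice (ϖ ^ d₀) v.1} =
      {⟨stdLattice K 3, 0, isSelfDualLattice_stdLattice_three_of_v hϖ⟩} := by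
  ext v
  simp only [Set.mem_setOf_eq, Set.mem_singleton_iff]
  constructor
  · rintro ⟨-, hSD, hlev⟩
    -- move to the block model along `M ↦ P⁻¹·M`
    set M' : Submodule 𝒪[K] (Fin 3 → K) := mapGL P⁻¹ v.1 with hM'
    have hv1 : v.1 = mapGL P M' := by rw [hM', ← mapGL_mul, mul_inv_cancel, mapGL_one]
    have hSD' : IsSelfDualLattice σ ϖ (!![(Matrix.diagonal d) 0 0, 0, (Matrix.diagonal d) 0 1; 0, η, 0; (Matrix.diagonal d) 1 0, 0, (Matrix.diagonal d) 1 1] : Matrix (Fin 3) (Fin 3) K) M' := by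
      rw [← hP, isSelfDualLattice_formCongr_iff, ← hv1]; exact hSD
    have hlev' : M'.map ((Matrix.toLin' ((((endoGL (γ₁, u) : GL (Fin 3) K) : Matrix (Fin 3) (Fin 3) K) - 1))).restrictScalars 𝒪[K]) ≤ scaleLattice (ϖ ^ d₀) M' := by
      rw [← map_conj_sub_one_le_scaleLattice_iff P (endoGL (γ₁, u)) (ϖ ^ d₀) M', ← hγ, ← hv1]; exact hlev
    have hM'0 := eq_stdLattice_of_selfDual_lev_of_anisotropic σ hσ hvσ hϖ hd hdσ hanis₀ hanis₁ hη hησ γ₁ u hT hSD'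
      (forall_mulVec_mem_scaleLattice_of_map_le _ _ _ hlev')
    apply Subtype.ext
    change v.1 = stdLattice K 3
    rw [hv1, hM'0, hP0]
  · rintro rfl
    refine ⟨?_, isSelfDualLattice_stdLattice_three_of_v hϖ, hroot⟩
    apply Subtype.ext
    rw [latticeGraphIso_apply_coe]
    exact mapGL_stdLattice_of_mem_unitaryInt hγ0

set_option maxHeartbeats 800000 in
-- budget only: statement-heavy lattice tokens.
/-- **THM 4 — THE `hR` BINDER OF ★ `strataCount_J₀_of_charpoly_block_raw_singleton` (F0P2-p02 (g14), p848877) AT THE ANISOTROPIC LITERAL**, pointwise form of THM 3: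
every vertex `v` with `γ·v = v ∧ SD v.1 ∧ (γ−1)·v.1 ≤ ϖ^{d₀}·v.1` is the root `r₀ = ⟨𝒪³, 0, _⟩`. [cite: Kottwitz1986, §3] [cite: BruhatTits1972, §10] [cite: Rogawski1990, §4.9 pp. 54–56] -/
theorem eq_root_of_latticeGraphIso_selfDual_lev_of_coe_eq_conj_endoGL [IsPrincipalIdealRing 𝒪[K]] {σ : K →+* K} {ϖ : K}
    (hσ : ∀ a, σ (σ a) = a) (hvσ : ∀ a, Valued.v (σ a) = Valued.v a) (hϖ : Valued.v ϖ = WithZero.exp (-1 : ℤ))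
    {d : Fin 2 → K} {η : K} (P : GL (Fin 3) K)
    (hP : formCongr σ P ((StdForm.antidiagonal 3).over K) =
      !![(Matrix.diagonal d) 0 0, 0, (Matrix.diagonal d) 0 1; 0, η, 0; (Matrix.diagonal d) 1 0, 0, (Matrix.diagonal d) 1 1])
    (hP0 : mapGL P (stdLattice K 3) = stdLattice K 3)
    (hd : ∀ i, Valued.v (d i) = 1) (hdσ : ∀ i, σ (d i) = d i)
    (hanis₀ : ∀ c : K, Valued.v c ≤ 1 → Valued.v (d 0 + d 1 * (σ c * c)) = 1)
    (hanis₁ : ∀ c : K, Valued.v c ≤ 1 → Valued.v (d 0 * (σ c * c) + d 1) = 1)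
    (hησ : σ η = η) (hη : Valued.v η = 1)
    (γ : unitaryGroupOfForm σ ((StdForm.antidiagonal 3).over K)) (hγ0 : γ ∈ unitaryInt σ ((StdForm.antidiagonal 3).over K))
    (γ₁ : GL (Fin 2) K) (u : GL (Fin 1) K) (hγ : (γ : GL (Fin 3) K) = P * endoGL (γ₁, u) * P⁻¹) {d₀ : ℕ}
    (hT : ∀ y : Fin 2 → K, (∀ i, Valued.v (y i) ≤ 1) → (∃ i, Valued.v (y i) = 1) →
      ∃ i, Valued.v ϖ ^ d₀ ≤ Valued.v ((((γ₁ : Matrix (Fin 2) (Fin 2) K) - (u : Matrix (Fin 1) (Fin 1) K) 0 0 • (1 : Matrix (Fin 2) (Fin 2) K)) *ᵥ y) i))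
    (hroot : (stdLattice K 3).map ((Matrix.toLin' (((γ : GL (Fin 3) K) : Matrix (Fin 3) (Fin 3) K) - 1)).restrictScalars 𝒪[K]) ≤ scaleLattice (ϖ ^ d₀) (stdLattice K 3)) :
    ∀ v : {M : Submodule 𝒪[K] (Fin 3 → K) // IsVertex σ ϖ ((StdForm.antidiagonal 3).over K) M},
      v ∈ {v : {M : Submodule 𝒪[K] (Fin 3 → K) // IsVertex σ ϖ ((StdForm.antidiagonal 3).over K) M} |
        latticeGraphIso σ ϖ ((StdForm.antidiagonal 3).over K) γ v = v ∧ IsSelfDualLattice σ ϖ ((StdForm.antidiagonal 3).over K) v.1 ∧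
          v.1.map ((Matrix.toLin' (((γ : GL (Fin 3) K) : Matrix (Fin 3) (Fin 3) K) - 1)).restrictScalars 𝒪[K]) ≤ scaleLattice (ϖ ^ d₀) v.1} →
      v = ⟨stdLattice K 3, 0, isSelfDualLattice_stdLattice_three_of_v hϖ⟩ := by
  intro v hv
  rw [setOf_latticeGraphIso_selfDual_lev_eq_singleton_of_coe_eq_conj_endoGL hσ hvσ hϖ P hP hP0 hd hdσ hanis₀ hanis₁ hησ hη γ hγ0 γ₁ u hγ hT hroot] at hv
  exact hv

end Literature.NumberTheory.Automorphic.UnitaryLatticeTree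

end
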